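import Literature.AlgebraicGeometry.Motives.AbelianVarietyBaseChange
import Literature.AlgebraicGeometry.Motives.FrobeniusMorphism
import Literature.AlgebraicGeometry.Motives.ZetaFunctionProofs
import HarnessLib

/-!
# Galois twists of a base change, the Frobenius endomorphism of an abelian variety over a finite
# field, and the absolute Frobenius of `P_K̄`

Tools for the descent of endomorphisms of an abelian variety `P` over a **finite** field `K = 𝔽_q`
from `P_K̄` to `P` (towards Tate's theorem `tate_bijective_of_finite`, J. Tate, *Endomorphisms of
abelian varieties over finite fields*, Invent. Math. 2 (1966), Main Theorem, whose in-tree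
assemblies need the semisimplicity of `End⁰_K(P)` while Poincaré's reducibility theorem is being
proved over `K̄` only):

* `AbelianVariety.galTwist L P σ` — for an abelian variety `P` over `K`, a field extension `L / K`
  and `σ ∈ Aut(L/K)`, the automorphism `1 × Spec σ` of the scheme `P_L = P ×_K Spec L` (a
  `K`-automorphism, `σ`-semilinear over `L`): `galTwist_fst`, `galTwist_snd`, `galTwist_one`,
  `galTwist_mul`, `galTwist_pow`, the isomorphism `galTwistIso`, and naturality
  (`toSchemeHom_baseChange_comp_galTwist`) (Görtz–Wedhorn I, (4.7) and (14.20); Milne, *Étale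
  cohomology*, VI §13, `1 ⊗ σ`);
* `AbelianVariety.frobeniusHom P : P ⟶ P` — for `K` finite with `q` elements, the `q`-Frobenius
  `F_{P/K}` (`Motives/FrobeniusMorphism.frobeniusOver`: identity on points, `s ↦ s^q` on functions,
  `K`-linear because `a^q = a` on `K`) **is a homomorphism of abelian varieties** (it commutes with
  every `K`-morphism, in particular with the unit and the group law) and is **central** in `End(P)`
  (`frobeniusHom_comp`, `commute_frobeniusHom`) (Tate 1966, §1: the Frobenius endomorphism `π`
  of `A` relative to `k` lies in the centre of `End_k(A)`; Milne, *The Work of John Tate*, §4.3;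
  Mumford, *Abelian Varieties*, §21);
* `AbelianVariety.toSchemeHom_frobeniusHom_pow` — `π_P^n` is the `qⁿ`-power endomorphism;
  `AbelianVariety.absFrobeniusPow_eq` — **the absolute `qⁿ`-Frobenius of the scheme `P_K̄` is
  `(πⁿ)_K̄` followed by the twist by the arithmetic Frobenius `φⁿ ∈ Gal(K̄/K)`** (Milne, *Étale
  cohomology*, VI Lemma 13.2 / Rem. 13.5: `Frob = (F_{X/k} ⊗ 1) ∘ (1 ⊗ φ)` on `X ⊗_k k̄`);
  consequences: an endomorphism of the scheme `P_K̄` commuting with the twist by `φⁿ` commutes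
  with `(πⁿ)_K̄` (`comp_toSchemeHom_baseChange_frobeniusHom_pow_of_galTwist`); the power
  endomorphisms of a reduced scheme are epimorphisms (`epi_powEndo`: identity on points,
  `s ↦ s^{q}` injective on reduced rings), hence **`(πⁿ)_K̄` is an epimorphism of schemes**
  (`epi_toSchemeHom_baseChange_frobeniusHom_pow`), and an endomorphism of `P_K̄` commuting with
  `(πⁿ)_K̄` commutes with the twist by `φⁿ` (`galTwist_comp_of_comp_frobeniusHom_pow`).

Everything is proved; no definition of a `Prop`, no named fact (D-0026). Mathlib has no Frobenius
morphism of schemes and no bundled abelian varieties; the tree's `powEndo` / `frobeniusOver`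
(`Motives/FrobeniusMorphism`) and `AbelianVariety.baseChange` / `Hom.baseChange`
(`Motives/AbelianVarietyProjective`, `Motives/AbelianVarietyBaseChange`) are used.

## References

* [Tate1966Endomorphisms] J. Tate, *Endomorphisms of abelian varieties over finite fields*,
  Invent. Math. 2 (1966), 134–144, §1 (the Frobenius endomorphism `π ∈ End_k(A)` is central) —
  not held (doi:10.1007/bf01404549); as reported in Milne, *The Work of John Tate*, §4.3
  (arXiv:1210.7459, held).
* [Milne2025] J. S. Milne, *Étale cohomology*, VI §13, Lemma 13.2 and Rem. 13.5 (p. 302)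
  (absolute, relative and arithmetic Frobenius: `F_{X̄} = (F_{X/k} ⊗ 1) ∘ (1 ⊗ φ)`); V Cor. 2.6.
* [Milne2013WorkOfTate] J. S. Milne, *The Work of John Tate*, §4.3 (arXiv:1210.7459, held).
* [MumfordAV1970] D. Mumford, *Abelian Varieties* (1970), §21 (the Frobenius morphism).
* [GortzWedhorn2020] U. Görtz, T. Wedhorn, *Algebraic Geometry I*, 2nd ed. (2020), (4.7) (base
  change), (14.20) (Galois descent: the twisted action `1 × Spec σ` on `X ⊗_k K`).
* [Hartshorne1977] R. Hartshorne, *Algebraic Geometry*, IV Rem. 2.4.1 (Frobenius commutes with all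
  morphisms).
-/

noncomputable section

universe u

open CategoryTheory CategoryTheory.Limits AlgebraicGeometry MonoidalCategory

namespace Literature.AlgebraicGeometry.Motives

/-! ## Power endomorphisms: `F = 𝟙` when `s ↦ sⁿ` is the identity, and epimorphy on reduced schemes -/

section PowEndo

variable (X : Scheme.{u})

/-- A power endomorphism whose power map is the identity on all sections (e.g. `n = 1`) is the
identity. [folklore] -/
theorem powEndo_eq_id {n : ℕ} (hn : n ≠ 0)
    (hadd : ∀ (U : X.Opens) (a b : Γ(X, U)), (a + b) ^ n = a ^ n + b ^ n)
    (h : ∀ (U : X.Opens) (s : Γ(X, U)), s ^ n = s) : powEndo X n hn hadd = 𝟙 X := by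
  refine Scheme.Hom.ext (by rfl) fun U ↦ ?_
  ext s
  change (X.presheaf.map (eqToHom (rfl : U = U)).op).hom (s ^ n) = s
  simp only [eqToHom_refl, op_id, CategoryTheory.Functor.map_id, CommRingCat.hom_id,
    RingHom.id_apply, h]

/-- Power endomorphisms with equal exponents are equal (the exponent enters the type of the
additivity hypothesis, so this is not a plain `congrArg`). [folklore] -/
theorem powEndo_exponent_congr {m n : ℕ} (h : m = n) (hm : m ≠ 0) (hn : n ≠ 0)
    (haddm : ∀ (U : X.Opens) (a b : Γ(X, U)), (a + b) ^ m = a ^ m + b ^ m)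
    (haddn : ∀ (U : X.Opens) (a b : Γ(X, U)), (a + b) ^ n = a ^ n + b ^ n) :
    powEndo X m hm haddm = powEndo X n hn haddn := by
  subst h
  rfl

variable {X} in
/-- On a reduced ring, an additive power map `s ↦ sⁿ` is injective: if `aⁿ = bⁿ` then
`(a - b)ⁿ = 0`, so `a - b` is nilpotent, hence zero. [folklore] -/
theorem pow_injective_of_isReduced {R : Type*} [CommRing R] [IsReduced R] {n : ℕ}
    (hadd : ∀ a b : R, (a + b) ^ n = a ^ n + b ^ n) :
    Function.Injective fun a : R ↦ a ^ n := by
  intro a b hab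
  have h : (a - b) ^ n = 0 := by
    have := hadd (a - b) b
    rw [sub_add_cancel] at this
    change a ^ n = b ^ n at hab
    rw [hab] at this
    exact add_eq_right.mp this.symm
  exact sub_eq_zero.mp (IsNilpotent.eq_zero ⟨n, h⟩)

/-- Transport along `eqToHom`s back and forth is the identity on sections. [folklore] -/
theorem presheaf_map_eqToHom_map_eqToHom {V W : X.Opens} (e₁ : V = W) (e₂ : W = V)
    (t : Γ(X, V)) :
    X.presheaf.map (eqToHom e₁).op (X.presheaf.map (eqToHom e₂).op t) = t := by
  subst e₁
  simp

/-- **The power endomorphisms of a reduced scheme are epimorphisms**: they are the identity on the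
underlying space and `s ↦ sⁿ` on sections, which is injective on reduced rings (for the Frobenius:
Hartshorne IV Rem. 2.4.1; Görtz–Wedhorn I, Exercise 4.25). [folklore] -/
theorem epi_powEndo [IsReduced X] (n : ℕ) (hn : n ≠ 0)
    (hadd : ∀ (U : X.Opens) (a b : Γ(X, U)), (a + b) ^ n = a ^ n + b ^ n) :
    Epi (powEndo X n hn hadd) := by
  refine ⟨fun {Y} a b H ↦ ?_⟩
  have hbase : a.base = b.base := by
    have := congrArg (fun f ↦ f.base) H
    simpa only [Scheme.Hom.comp_base, powEndo_base, Category.id_comp] using this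
  refine Scheme.Hom.ext hbase fun U ↦ ?_
  ext s
  -- compare `n`-th powers in the reduced ring `Γ(X, b⁻¹ U)`
  apply pow_injective_of_isReduced (hadd ((TopologicalSpace.Opens.map b.base).obj U))
  -- `H` on sections over `U`, evaluated at `s`: `(a^* s)ⁿ = (b^* s)ⁿ` up to transport
  have hU := DFunLike.congr_fun (congrArg CommRingCat.Hom.hom (Scheme.Hom.congr_app H U)) s
  -- `hU : (a^* s)ⁿ = transport ((b^* s)ⁿ)`, definitionally
  have hU' : (a.app U).hom s ^ n =
      (X.presheaf.map (eqToHom _).op).hom ((b.app U).hom s ^ n) := hU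
  change ((X.presheaf.map (eqToHom _).op).hom ((a.app U).hom s)) ^ n = ((b.app U).hom s) ^ n
  rw [← map_pow, hU']
  exact presheaf_map_eqToHom_map_eqToHom X _ _ _

end PowEndo

namespace AbelianVariety

/-! ## Galois twists `1 × Spec σ` of a base change `P ×_K Spec L` -/

section Twist

variable {K : Type u} [Field K] (L : Type u) [Field L] [Algebra K L]

/-- `Hom.toSchemeHom` is multiplicative for the composition in `End P` (`f * g = g ≫ f`).
[folklore] -/
theorem toSchemeHom_mul {P : AbelianVariety K} (f g : End P) :
    Hom.toSchemeHom (f * g) = Hom.toSchemeHom g ≫ Hom.toSchemeHom f := rfl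

/-- `Hom.toSchemeHom 1 = 𝟙`. [folklore] -/
theorem toSchemeHom_one (P : AbelianVariety K) : Hom.toSchemeHom (1 : End P) = 𝟙 P.X.left := rfl

/-- `Spec σ ≫ (Spec L → Spec K) = (Spec L → Spec K)` for `σ ∈ Aut(L/K)`. [folklore] -/
@[reassoc]
theorem specMap_algEquiv_comp_bcSpec (σ : L ≃ₐ[K] L) :
    Spec.map (CommRingCat.ofHom (σ : L →+* L)) ≫ bcSpec K L = bcSpec K L :=
  Over.w (AlgPoints.specMap σ)

variable (P : AbelianVariety K)

/-- The projection `P_L = P ×_K Spec L → P`, with source *syntactically* the underlying scheme of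
`P.baseChange L` (it is `pullback.fst`, `Motives/AbelianVarietyProjective.baseChange_X_left`; the
wrapper pins the form of the source so that rewriting lemmas compose). [folklore] -/
def bcFst : (P.baseChange L).X.left ⟶ P.X.left := pullback.fst P.X.hom (bcSpec K L)

/-- The structure morphism `P_L → Spec L`, with source syntactically the underlying scheme of
`P.baseChange L` (it is `pullback.snd`). [folklore] -/
def bcSnd : (P.baseChange L).X.left ⟶ Spec (.of L) := pullback.snd P.X.hom (bcSpec K L)

/-- `bcFst` is the first projection of the fibre product (by definition). [folklore] -/
theorem bcFst_def : bcFst L P = pullback.fst P.X.hom (bcSpec K L) := rfl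

/-- `bcSnd` is the second projection of the fibre product (by definition). [folklore] -/
theorem bcSnd_def : bcSnd L P = pullback.snd P.X.hom (bcSpec K L) := rfl

/-- The structure morphism of `P_L` is `bcSnd` (by construction of `AbelianVariety.baseChange`).
[folklore] -/
theorem baseChange_X_hom_eq_bcSnd : (P.baseChange L).X.hom = bcSnd L P := rfl

/-- The cartesian square of `P_L`: `pr_P ≫ (P → Spec K) = pr_{Spec L} ≫ (Spec L → Spec K)`.
[folklore] -/
@[reassoc]
theorem bcFst_comp_hom : bcFst L P ≫ P.X.hom = bcSnd L P ≫ bcSpec K L := pullback.condition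

/-- Morphisms into `P_L = P ×_K Spec L` are determined by their two projections (universal
property of the fibre product, for the underlying scheme of `P.baseChange L`). [folklore] -/
theorem baseChange_hom_ext {Z : Scheme.{u}} {a b : Z ⟶ (P.baseChange L).X.left}
    (h₁ : a ≫ bcFst L P = b ≫ bcFst L P) (h₂ : a ≫ bcSnd L P = b ≫ bcSnd L P) : a = b :=
  pullback.hom_ext h₁ h₂

variable {P} in
/-- `f_L ≫ pr_Q = pr_P ≫ f` (`Motives/AbelianVarietyBaseChange.toSchemeHom_baseChange_comp_fst`).
[folklore] -/
@[reassoc]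
theorem toSchemeHom_baseChange_comp_bcFst {Q : AbelianVariety K} (f : P ⟶ Q) :
    Hom.toSchemeHom (Hom.baseChange L f) ≫ bcFst L Q = bcFst L P ≫ Hom.toSchemeHom f :=
  toSchemeHom_baseChange_comp_fst L f

variable {P} in
/-- `f_L` is a morphism over `Spec L` (`toSchemeHom_baseChange_comp_snd`). [folklore] -/
@[reassoc]
theorem toSchemeHom_baseChange_comp_bcSnd {Q : AbelianVariety K} (f : P ⟶ Q) :
    Hom.toSchemeHom (Hom.baseChange L f) ≫ bcSnd L Q = bcSnd L P :=
  toSchemeHom_baseChange_comp_snd L f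

/-- **The Galois twist** of the base change `P_L = P ×_K Spec L` of an abelian variety `P` over
`K` by `σ ∈ Aut(L/K)`: the automorphism `1 × Spec σ` of the scheme `P_L` (a morphism of
`K`-schemes, `σ`-semilinear over `Spec L`; Görtz–Wedhorn I, (14.20); Milne, *Étale cohomology*,
VI §13). [folklore] -/
def galTwist (σ : L ≃ₐ[K] L) : (P.baseChange L).X.left ⟶ (P.baseChange L).X.left :=
  pullback.map P.X.hom (bcSpec K L) P.X.hom (bcSpec K L) (𝟙 P.X.left)
    (Spec.map (CommRingCat.ofHom (σ : L →+* L))) (𝟙 _) (by simp)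
    (by rw [Category.comp_id, specMap_algEquiv_comp_bcSpec])

/-- The twist lies over the identity of `P`: `(1 × Spec σ) ≫ pr_P = pr_P`. [folklore] -/
@[reassoc (attr := simp)]
theorem galTwist_fst (σ : L ≃ₐ[K] L) : galTwist L P σ ≫ bcFst L P = bcFst L P :=
  (pullback.lift_fst _ _ _).trans (Category.comp_id _)

/-- The twist is `σ`-semilinear: `(1 × Spec σ) ≫ pr_{Spec L} = pr_{Spec L} ≫ Spec σ`. [folklore] -/
@[reassoc (attr := simp)]
theorem galTwist_snd (σ : L ≃ₐ[K] L) :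
    galTwist L P σ ≫ bcSnd L P = bcSnd L P ≫ Spec.map (CommRingCat.ofHom (σ : L →+* L)) :=
  pullback.lift_snd _ _ _

/-- The twist by the identity is the identity. [folklore] -/
@[simp]
theorem galTwist_one : galTwist L P 1 = 𝟙 _ := by
  have h1 : ((1 : L ≃ₐ[K] L) : L →+* L) = RingHom.id L := RingHom.ext fun _ ↦ rfl
  apply baseChange_hom_ext
  · rw [galTwist_fst, Category.id_comp]
  · rw [galTwist_snd, Category.id_comp, h1, CommRingCat.ofHom_id, Spec.map_id, Category.comp_id]

/-- Twists compose like the automorphisms (in the order of `AlgPoints.specMap_mul`: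
`σ * τ = σ ∘ τ` and `Spec` is contravariant): `1 × Spec (σ τ) = (1 × Spec σ) ≫ (1 × Spec τ)`.
[folklore] -/
theorem galTwist_mul (σ τ : L ≃ₐ[K] L) :
    galTwist L P (σ * τ) = galTwist L P σ ≫ galTwist L P τ := by
  have h1 : ((σ * τ : L ≃ₐ[K] L) : L →+* L) = (σ : L →+* L).comp τ := RingHom.ext fun _ ↦ rfl
  apply baseChange_hom_ext
  · rw [galTwist_fst, Category.assoc, galTwist_fst, galTwist_fst]
  · rw [galTwist_snd, Category.assoc, galTwist_snd, galTwist_snd_assoc, h1, CommRingCat.ofHom_comp,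
      Spec.map_comp]

/-- Twists by powers are powers of the twist. [folklore] -/
theorem galTwist_pow (σ : L ≃ₐ[K] L) (n : ℕ) :
    galTwist L P (σ ^ n) = End.of (galTwist L P σ) ^ n := by
  induction n with
  | zero => rw [pow_zero, pow_zero, galTwist_one]; rfl
  | succ n ih => rw [pow_succ', galTwist_mul, ih, pow_succ, End.mul_def]

/-- **The Galois twist is an automorphism** of the scheme `P_L`, with inverse the twist by `σ⁻¹`.
[folklore] -/
@[simps]
def galTwistIso (σ : L ≃ₐ[K] L) : (P.baseChange L).X.left ≅ (P.baseChange L).X.left where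
  hom := galTwist L P σ
  inv := galTwist L P σ⁻¹
  hom_inv_id := by rw [← galTwist_mul, mul_inv_cancel, galTwist_one]
  inv_hom_id := by rw [← galTwist_mul, inv_mul_cancel, galTwist_one]

/-- The Galois twist is an isomorphism. [folklore] -/
instance isIso_galTwist (σ : L ≃ₐ[K] L) : IsIso (galTwist L P σ) :=
  (galTwistIso L P σ).isIso_hom

variable {P} in
/-- **Naturality of the twist**: for a homomorphism `f : P → Q` over `K`,
`f_L ≫ (1 × Spec σ) = (1 × Spec σ) ≫ f_L` on underlying schemes. [folklore] -/
@[reassoc]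
theorem toSchemeHom_baseChange_comp_galTwist {Q : AbelianVariety K} (f : P ⟶ Q) (σ : L ≃ₐ[K] L) :
    Hom.toSchemeHom (Hom.baseChange L f) ≫ galTwist L Q σ =
      galTwist L P σ ≫ Hom.toSchemeHom (Hom.baseChange L f) := by
  apply baseChange_hom_ext
  · rw [Category.assoc, galTwist_fst, toSchemeHom_baseChange_comp_bcFst, Category.assoc,
      toSchemeHom_baseChange_comp_bcFst, galTwist_fst_assoc]
  · rw [Category.assoc, galTwist_snd, toSchemeHom_baseChange_comp_bcSnd_assoc, Category.assoc,
      toSchemeHom_baseChange_comp_bcSnd, galTwist_snd]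

end Twist

/-! ## The Frobenius endomorphism of an abelian variety over a finite field -/

section Frobenius

variable {K : Type u} [Field K] [Finite K]

/-- The `q`-Frobenius of the unit `Spec K` of `K`-schemes is the identity (`Spec K` is terminal).
[folklore] -/
theorem frobeniusOver_tensorUnit : frobeniusOver (𝟙_ (SchemeOver K)) = 𝟙 _ :=
  CartesianMonoidalCategory.toUnit_unique _ _

/-- The `q`-Frobenius of a product is the product of the Frobenii (both commute with the
projections). [folklore] -/
theorem frobeniusOver_tensorObj (X Y : SchemeOver K) :
    frobeniusOver (X ⊗ Y) = frobeniusOver X ⊗ₘ frobeniusOver Y := by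
  apply CartesianMonoidalCategory.hom_ext
  · rw [CartesianMonoidalCategory.tensorHom_fst, frobeniusOver_comp]
  · rw [CartesianMonoidalCategory.tensorHom_snd, frobeniusOver_comp]

open scoped MonObj

variable (P Q : AbelianVariety K)

/-- **The Frobenius endomorphism `π_P = F_{P/K}` of an abelian variety `P` over the finite field
`K = 𝔽_q` is a homomorphism of abelian varieties**: the `q`-Frobenius `F_{P/K}`
(`frobeniusOver P.X`) commutes with every `K`-morphism (Hartshorne IV Rem. 2.4.1), in particular
with the unit `Spec K → P` and with the group law `P × P → P` (using `F_{Spec K} = 1`,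
`F_{P × P} = F_P × F_P`) (Tate 1966, §1; Mumford §21, the Frobenius morphism `π : X → X`).
[cite: Tate1966Endomorphisms, §1] -/
def frobeniusHom : P ⟶ P :=
  InducedCategory.homMk (Grp.homMk'' (A := P.toGrp) (B := P.toGrp) (frobeniusOver P.X)
    (by rw [← frobeniusOver_comp, frobeniusOver_tensorUnit, Category.id_comp])
    (by rw [← frobeniusOver_comp, frobeniusOver_tensorObj]))

/-- On `K`-schemes, `π_P` is the `q`-Frobenius `F_{P/K}`. [folklore] -/
@[simp]
theorem frobeniusHom_hom_hom_hom : (frobeniusHom P).hom.hom.hom = frobeniusOver P.X := rfl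

/-- On schemes, `π_P` is the `q`-power endomorphism. [folklore] -/
theorem toSchemeHom_frobeniusHom :
    Hom.toSchemeHom (frobeniusHom P) =
      powEndo P.X.left (Nat.card K) card_ne_zero (add_pow_card_sections P.X) := rfl

variable {P Q} in
/-- **`π` commutes with every homomorphism**: `π_P ≫ f = f ≫ π_Q` (naturality of the Frobenius,
Hartshorne IV Rem. 2.4.1; Tate 1966, §1). [cite: Tate1966Endomorphisms, §1] -/
@[reassoc]
theorem frobeniusHom_comp (f : P ⟶ Q) : frobeniusHom P ≫ f = f ≫ frobeniusHom Q :=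
  hom_ext _ _ (by
    change frobeniusOver P.X ≫ f.hom.hom.hom = f.hom.hom.hom ≫ frobeniusOver Q.X
    exact frobeniusOver_comp _)

/-- **`π_P` is central in `End(P)`** (Tate 1966, §1: `π` lies in the centre of `End_k(A)`).
[cite: Tate1966Endomorphisms, §1] -/
theorem commute_frobeniusHom (f : End P) : Commute (End.of (frobeniusHom P)) f := by
  change End.of (frobeniusHom P) * f = f * End.of (frobeniusHom P)
  rw [End.mul_def, End.mul_def]
  exact (frobeniusHom_comp f).symm

/-- Powers of `π_P` are central. [folklore] -/
theorem commute_frobeniusHom_pow (f : End P) (n : ℕ) :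
    Commute (End.of (frobeniusHom P) ^ n) f :=
  (commute_frobeniusHom P f).pow_left n

/-- Sections of a `K`-scheme have additive `qⁿ`-th powers (`q = #K`). [folklore] -/
theorem add_pow_card_pow_sections (X : SchemeOver K) (n : ℕ) (U : X.left.Opens)
    (a b : Γ(X.left, U)) :
    (a + b) ^ Nat.card K ^ n = a ^ Nat.card K ^ n + b ^ Nat.card K ^ n := by
  induction n with
  | zero => simp
  | succ n ih => rw [pow_succ, pow_mul, ih, add_pow_card_sections, ← pow_mul, ← pow_mul]

/-- `qⁿ ≠ 0`. [folklore] -/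
theorem card_pow_ne_zero (n : ℕ) : Nat.card K ^ n ≠ 0 := pow_ne_zero n card_ne_zero

/-- **`π_P^n` is the `qⁿ`-power endomorphism** of the scheme `P`. [folklore] -/
theorem toSchemeHom_frobeniusHom_pow (n : ℕ) :
    Hom.toSchemeHom (End.of (frobeniusHom P) ^ n) =
      powEndo P.X.left (Nat.card K ^ n) (card_pow_ne_zero n)
        (add_pow_card_pow_sections P.X n) := by
  induction n with
  | zero =>
    rw [pow_zero, toSchemeHom_one]
    exact (powEndo_eq_id P.X.left _ _ (fun U s ↦ by rw [pow_zero, pow_one])).symm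
  | succ n ih =>
    rw [pow_succ, toSchemeHom_mul, ih]
    change powEndo P.X.left (Nat.card K) card_ne_zero (add_pow_card_sections P.X) ≫ _ = _
    rw [powEndo_comp_powEndo (haddmn := fun U a b ↦ by
      rw [← pow_succ']; exact add_pow_card_pow_sections P.X (n + 1) U a b)]
    exact powEndo_exponent_congr P.X.left (pow_succ' _ _).symm _ _ _ _

end Frobenius

/-! ## The absolute Frobenius of `P_K̄`: `Frob_{qⁿ} = (πⁿ)_K̄ ≫ (1 × Spec φⁿ)` and consequences -/

section AbsoluteFrobenius

variable {K : Type u} [Field K] [Finite K]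

/-- Additivity of `a ↦ a^{qⁿ}` on commutative `K`-algebras (`q = #K`). [folklore] -/
theorem add_pow_card_pow_algebra (A : Type*) [CommRing A] [Algebra K A] (n : ℕ) (a b : A) :
    (a + b) ^ Nat.card K ^ n = a ^ Nat.card K ^ n + b ^ Nat.card K ^ n := by
  induction n with
  | zero => simp
  | succ n ih => rw [pow_succ, pow_mul, ih, add_pow_card_algebra, ← pow_mul, ← pow_mul]

variable (K) in
/-- The arithmetic Frobenius `φ : x ↦ x^q` of `K̄` as a `K`-algebra automorphism (the tree's
`arithFrob K ∈ Gal(K̄/K)` through `Field.absoluteGaloisGroup.toAlgEquiv`). [folklore] -/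
abbrev arithFrobAlgEquiv : AlgebraicClosure K ≃ₐ[K] AlgebraicClosure K :=
  Field.absoluteGaloisGroup.toAlgEquiv K (arithFrob K)

/-- `φⁿ(x) = x^{qⁿ}` on `K̄`. [folklore] -/
theorem arithFrobAlgEquiv_pow_apply (n : ℕ) (x : AlgebraicClosure K) :
    (arithFrobAlgEquiv K ^ n) x = x ^ Nat.card K ^ n := by
  rw [← map_pow, ← Field.absoluteGaloisGroup.smul_def, arithFrob_pow_smul]

/-- As a ring endomorphism of `K̄`, `φⁿ` is the `qⁿ`-power map. [folklore] -/
theorem coe_arithFrobAlgEquiv_pow (n : ℕ) :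
    ((arithFrobAlgEquiv K ^ n : AlgebraicClosure K ≃ₐ[K] AlgebraicClosure K) :
        AlgebraicClosure K →+* AlgebraicClosure K) =
      powRingHom (AlgebraicClosure K) (Nat.card K ^ n) (card_pow_ne_zero n)
        (add_pow_card_pow_algebra (AlgebraicClosure K) n) := by
  ext x
  rw [powRingHom_apply]
  exact arithFrobAlgEquiv_pow_apply n x

variable (P : AbelianVariety K)

/-- `P_K̄` as a `K`-scheme (forgetting down along `Spec K̄ → Spec K`); its underlying scheme is
that of `P.baseChange K̄`, definitionally. [folklore] -/
abbrev baseChangeOverK : SchemeOver K :=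
  (Over.map (bcSpec K (AlgebraicClosure K))).obj (P.baseChange (AlgebraicClosure K)).X

/-- Sections of `P_K̄` have additive `qⁿ`-th powers (it is a `K`-scheme). [folklore] -/
theorem add_pow_card_pow_sections_baseChange (n : ℕ)
    (U : (P.baseChange (AlgebraicClosure K)).X.left.Opens)
    (a b : Γ((P.baseChange (AlgebraicClosure K)).X.left, U)) :
    (a + b) ^ Nat.card K ^ n = a ^ Nat.card K ^ n + b ^ Nat.card K ^ n :=
  add_pow_card_pow_sections (baseChangeOverK P) n U a b

/-- **The absolute `qⁿ`-Frobenius of the scheme `P_K̄`** (identity on points, `s ↦ s^{qⁿ}` on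
functions). [folklore] -/
abbrev absFrobeniusPow (n : ℕ) :
    (P.baseChange (AlgebraicClosure K)).X.left ⟶ (P.baseChange (AlgebraicClosure K)).X.left :=
  powEndo (P.baseChange (AlgebraicClosure K)).X.left (Nat.card K ^ n) (card_pow_ne_zero n)
    (add_pow_card_pow_sections_baseChange P n)

/-- `(πⁿ)_K̄`, the base change to `K̄` of the `n`-th power of the Frobenius endomorphism, as an
endomorphism of the scheme `P_K̄`. [folklore] -/
abbrev frobeniusPowBaseChange (n : ℕ) :
    (P.baseChange (AlgebraicClosure K)).X.left ⟶ (P.baseChange (AlgebraicClosure K)).X.left :=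
  Hom.toSchemeHom (Hom.baseChange (AlgebraicClosure K) (End.of (frobeniusHom P) ^ n))

/-- Base change is compatible with powers in `End`: `(πⁿ)_K̄ = (π_K̄)ⁿ`. [folklore] -/
theorem baseChange_frobeniusHom_pow (L : Type u) [Field L] [Algebra K L] (n : ℕ) :
    Hom.baseChange L (End.of (frobeniusHom P) ^ n) =
      End.of (Hom.baseChange L (frobeniusHom P)) ^ n :=
  map_pow ((baseChangeFunctor K L).mapEnd P) _ n

/-- **The absolute `qⁿ`-Frobenius of `P_K̄` is `(πⁿ)_K̄` followed by the Galois twist by `φⁿ`**,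
`φ = (x ↦ x^q) ∈ Gal(K̄/K)`: both are the `qⁿ`-power map of `P` on the first factor, and on the
second factor `Spec K̄` the absolute Frobenius is `Spec φⁿ` (Milne, *Étale cohomology*, VI
Lemma 13.2 and Rem. 13.5: `F_{X̄} = F_{X/k} ⊗ 1` composed with `1 ⊗ φ` is the absolute
Frobenius of `X̄ = X ⊗_k k̄`). [cite: Milne2025, VI Rem. 13.5 (p. 302)] -/
theorem absFrobeniusPow_eq (n : ℕ) :
    absFrobeniusPow P n =
      frobeniusPowBaseChange P n ≫
        galTwist (AlgebraicClosure K) P (arithFrobAlgEquiv K ^ n) := by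
  apply baseChange_hom_ext
  · rw [Category.assoc, galTwist_fst, toSchemeHom_baseChange_comp_bcFst,
      toSchemeHom_frobeniusHom_pow]
    exact powEndo_comp _ _ _ (bcFst (AlgebraicClosure K) P) (add_pow_card_pow_sections P.X n)
  · rw [Category.assoc, galTwist_snd, toSchemeHom_baseChange_comp_bcSnd_assoc,
      coe_arithFrobAlgEquiv_pow, ← powEndo_Spec (Nat.card K ^ n) (card_pow_ne_zero n)
        (AlgebraicClosure K) (add_pow_card_pow_algebra (AlgebraicClosure K) n)
        (add_pow_card_pow_sections (specOver K (AlgebraicClosure K)) n)]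
    exact powEndo_comp _ _ _ (bcSnd (AlgebraicClosure K) P) _

/-- `(πⁿ)_K̄` commutes with every Galois twist (it is the base change of a `K`-morphism).
[folklore] -/
@[reassoc]
theorem frobeniusPowBaseChange_comp_galTwist (n : ℕ)
    (τ : AlgebraicClosure K ≃ₐ[K] AlgebraicClosure K) :
    frobeniusPowBaseChange P n ≫ galTwist (AlgebraicClosure K) P τ =
      galTwist (AlgebraicClosure K) P τ ≫ frobeniusPowBaseChange P n :=
  toSchemeHom_baseChange_comp_galTwist _ _ τ

/-- The other factorisation: `Frob_{qⁿ} = (1 × Spec φⁿ) ≫ (πⁿ)_K̄`. [folklore] -/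
theorem absFrobeniusPow_eq' (n : ℕ) :
    absFrobeniusPow P n =
      galTwist (AlgebraicClosure K) P (arithFrobAlgEquiv K ^ n) ≫ frobeniusPowBaseChange P n := by
  rw [absFrobeniusPow_eq, frobeniusPowBaseChange_comp_galTwist]

/-- The absolute Frobenius commutes with every endomorphism of the scheme `P_K̄`. [folklore] -/
@[reassoc]
theorem absFrobeniusPow_comp (n : ℕ)
    (g : (P.baseChange (AlgebraicClosure K)).X.left ⟶ (P.baseChange (AlgebraicClosure K)).X.left) :
    absFrobeniusPow P n ≫ g = g ≫ absFrobeniusPow P n :=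
  powEndo_comp _ _ _ g _

/-- **An endomorphism of the scheme `P_K̄` commuting with the twist by `φⁿ` commutes with
`(πⁿ)_K̄`** (both commute with the absolute Frobenius `Frob_{qⁿ} = (πⁿ)_K̄ ≫ (1 × Spec φⁿ)`; cancel
the automorphism `1 × Spec φⁿ`). [folklore] -/
theorem frobeniusPowBaseChange_comp_of_galTwist_comp (n : ℕ)
    {g : (P.baseChange (AlgebraicClosure K)).X.left ⟶ (P.baseChange (AlgebraicClosure K)).X.left}
    (hg : galTwist (AlgebraicClosure K) P (arithFrobAlgEquiv K ^ n) ≫ g =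
      g ≫ galTwist (AlgebraicClosure K) P (arithFrobAlgEquiv K ^ n)) :
    frobeniusPowBaseChange P n ≫ g = g ≫ frobeniusPowBaseChange P n := by
  have h := absFrobeniusPow_comp P n g
  rw [absFrobeniusPow_eq, Category.assoc, hg, ← Category.assoc, ← Category.assoc] at h
  exact (cancel_mono _).mp h

/-- **`(πⁿ)_K̄` is an epimorphism of schemes**: `(1 × Spec φⁿ) ≫ (πⁿ)_K̄` is the absolute
Frobenius of the reduced scheme `P_K̄`, an epimorphism (`epi_powEndo`). [folklore] -/
theorem epi_frobeniusPowBaseChange (n : ℕ) : Epi (frobeniusPowBaseChange P n) := by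
  haveI : IsIntegral (P.baseChange (AlgebraicClosure K)).X.left :=
    GeometricallyIntegral.isIntegral_of_subsingleton (P.baseChange (AlgebraicClosure K)).X.hom
  haveI : Epi (galTwist (AlgebraicClosure K) P (arithFrobAlgEquiv K ^ n) ≫
      frobeniusPowBaseChange P n) := by
    rw [← absFrobeniusPow_eq']
    exact epi_powEndo _ _ _ _
  exact epi_of_epi (galTwist (AlgebraicClosure K) P (arithFrobAlgEquiv K ^ n)) _

/-- **An endomorphism of the scheme `P_K̄` commuting with `(πⁿ)_K̄` commutes with the twist by
`φⁿ`** (both commute with `Frob_{qⁿ} = (πⁿ)_K̄ ≫ (1 × Spec φⁿ)`; cancel the epimorphism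
`(πⁿ)_K̄`). This is the scheme-theoretic content of "an endomorphism commuting with the
Frobenius is defined over `𝔽_{qⁿ}`". [folklore] -/
theorem galTwist_comp_of_frobeniusPowBaseChange_comp (n : ℕ)
    {g : (P.baseChange (AlgebraicClosure K)).X.left ⟶ (P.baseChange (AlgebraicClosure K)).X.left}
    (hg : frobeniusPowBaseChange P n ≫ g = g ≫ frobeniusPowBaseChange P n) :
    galTwist (AlgebraicClosure K) P (arithFrobAlgEquiv K ^ n) ≫ g =
      g ≫ galTwist (AlgebraicClosure K) P (arithFrobAlgEquiv K ^ n) := by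
  haveI := epi_frobeniusPowBaseChange P n
  have h := absFrobeniusPow_comp P n g
  rw [absFrobeniusPow_eq, Category.assoc, ← Category.assoc g, ← hg, Category.assoc] at h
  exact (cancel_epi _).mp h

/-- For homomorphisms: an endomorphism `g` of the abelian variety `P_K̄` whose underlying
morphism commutes with the twist by `φⁿ` commutes with `(πⁿ)_K̄` in `End(P_K̄)`. [folklore] -/
theorem commute_baseChange_frobeniusHom_pow_of_galTwist_comp (n : ℕ)
    (g : End (P.baseChange (AlgebraicClosure K)))
    (hg : galTwist (AlgebraicClosure K) P (arithFrobAlgEquiv K ^ n) ≫ Hom.toSchemeHom g =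
      Hom.toSchemeHom g ≫ galTwist (AlgebraicClosure K) P (arithFrobAlgEquiv K ^ n)) :
    Commute (End.of (Hom.baseChange (AlgebraicClosure K) (frobeniusHom P)) ^ n) g := by
  rw [← baseChange_frobeniusHom_pow]
  change _ * g = g * _
  rw [End.mul_def, End.mul_def]
  exact hom_ext _ _ (Over.OverMorphism.ext
    (frobeniusPowBaseChange_comp_of_galTwist_comp P n hg).symm)

/-- For homomorphisms: an endomorphism `g` of `P_K̄` commuting with `(πⁿ)_K̄` in `End(P_K̄)` has
underlying morphism commuting with the twist by `φⁿ`. [folklore] -/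
theorem galTwist_comp_toSchemeHom_of_commute (n : ℕ) (g : End (P.baseChange (AlgebraicClosure K)))
    (hg : Commute (End.of (Hom.baseChange (AlgebraicClosure K) (frobeniusHom P)) ^ n) g) :
    galTwist (AlgebraicClosure K) P (arithFrobAlgEquiv K ^ n) ≫ Hom.toSchemeHom g =
      Hom.toSchemeHom g ≫ galTwist (AlgebraicClosure K) P (arithFrobAlgEquiv K ^ n) := by
  refine galTwist_comp_of_frobeniusPowBaseChange_comp P n ?_
  rw [← baseChange_frobeniusHom_pow] at hg
  have h : _ * g = g * _ := hg
  rw [End.mul_def, End.mul_def] at h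
  exact (congrArg Hom.toSchemeHom h).symm

/-- **`(πⁿ)_K̄` is left-cancellable in `End(P_K̄)`**: `g ∘ (πⁿ)_K̄ = g' ∘ (πⁿ)_K̄` implies
`g = g'` (in the ring `End(P_K̄)`, `g * πⁿ = g' * πⁿ → g = g'`). [folklore] -/
theorem eq_of_mul_baseChange_frobeniusHom_pow_eq (n : ℕ)
    {g g' : End (P.baseChange (AlgebraicClosure K))}
    (h : g * End.of (Hom.baseChange (AlgebraicClosure K) (frobeniusHom P)) ^ n =
      g' * End.of (Hom.baseChange (AlgebraicClosure K) (frobeniusHom P)) ^ n) : g = g' := by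
  haveI := epi_frobeniusPowBaseChange P n
  rw [← baseChange_frobeniusHom_pow, End.mul_def, End.mul_def] at h
  have h' := congrArg Hom.toSchemeHom h
  change frobeniusPowBaseChange P n ≫ Hom.toSchemeHom g =
    frobeniusPowBaseChange P n ≫ Hom.toSchemeHom g' at h'
  exact hom_ext _ _ (Over.OverMorphism.ext ((cancel_epi _).mp h'))

end AbsoluteFrobenius

end AbelianVariety

end Literature.AlgebraicGeometry.Motives
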